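import Summits.NavierStokesRegularity.FluidComputer.PalasekTowerTameCarrierAtRun
import Summits.NavierStokesRegularity.FluidComputer.PalasekTowerHeredityWitnessWindow

/-!
# The FREE-RUN LETTER of the first window is UNSATISFIABLE from every `L³`-small slot filler — in particular from
# some admissible tame carrier: Kato's tame run (`‖v‖ ≤ 2Y₀`) is THE free run (bounded-classical uniqueness), and
# `2Y₀ ≤ Y₁ < Y₁ + η`

Cell `ns-blowup`, seat `ns-blowup-refuter4` (g10, K207; ledger refuter of record for route `PalasekTowerBreakdown` rev 19,
crux stmt-NavierStokesRegularity-20303 `EpisodeBaseT := EpisodeBaseGAt TowerRates.tuned`). Negative-lane lemmas only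
(`Theorems/<Crux>/Negative/`): no definition, no Theses statement asserted or denied, nothing about Navier–Stokes decided
beyond the tree's own Kato/Leray and Serrin–Masuda theorems. LABEL: refuter kernel certificate (E–C typing). WHAT THIS IS NOT:
not NS evidence about the crux — it says which fillers CANNOT carry the free-run letter, and exhibits none that can.

ecbridge-3 (g8) landed the FREE-RUN DOOR at arbitrary rates (`Germ.LevelZeroDataAt.episodeBaseGAt_of_freeRun`, p532583) and,
BY NAME at `tuned`, `Theorems.palasekTowerBreakdown_episodeBaseT_of_levelZeroDataAt_freeRun` /
`…_of_tameCarrierAt_freeRun` (p533371): `EpisodeBaseT` ⇐ ANY strict-slot filler `U` at `tuned` + ONE classical finite-energy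
FREE run on `[1, τ₁(tuned)]` from `U` showing, with a margin `η > 0`, speed `≥ Y₁ + η`, gradient `≥ A₁ + η`, an `N₁`-core, under
`(5/3)Y₁ − η` — "what is left is ONE FREE Cauchy problem of the first tuned window from a named profile". This file records
which named profiles are EXCLUDED by the tree's own theorems:

* §1 `freeRun_norm_le_two_mul_of_small_L3` (R-generic): there is an absolute `c > 0` (Kato's threshold at `ν = 1`,
  `Literature.Analysis.FluidPDE.exists_classical_run_norm_le_two_mul_Icc`) such that for every smooth compactly supported
  divergence-free `U` with `‖U‖ ≤ Y₀(R)` and `‖U‖_{L³} ≤ c`, EVERY classical finite-energy free run `(v, q)` on `[1, τ₁(R)]` from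
  `v 1 = U` obeys `‖v t x‖ ≤ 2Y₀(R)` on the whole window (the Kato–Leray run is bounded, so it is THE run:
  `velocity_eq_of_bounded_classical_Icc`, Sohr's forced Serrin–Masuda uniqueness — a theorem of the tree);
* §2 `speedFace_false_of_small_L3`: under the registered band `2Y₀(R) ≤ Y₁(R)` such a run NEVER shows the speed face
  `Y₁(R) + η ≤ ‖v(τ₁) x‖` (`η > 0`) at any point — the free-run letter is unsatisfiable from `L³`-small fillers;
* §3 `exists_levelZeroDataAt_freeRun_letter_unsatisfiable`: by `Germ.exists_levelZeroDataAt_eLpNorm_le` SOME admissible tame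
  carrier `tameCarrierAt R a λ` (`LevelZeroDataAt R · 7`) is that small, so for it the hypothesis list of the free-run door is
  EMPTY; §4 the instances at `TowerRates.tuned` (`tuned_sep 0`), phrased against the exact hypothesis shape of p533371.

READING (planner / ecbridge lineage / LEAD 20303): the free-run letter's filler must have `‖U‖_{L³} > c_Kato` — scale-invariant
LARGENESS is necessary (no surprise to anyone, now by name in the kernel against the tuned letter); the tame family is a CARRIER
(for superposition doors), never the witness; `…_of_tameCarrierAt_freeRun` is vacuous on the Kato sub-box of its `(a, λ)` range
and an implausible genuine Cauchy problem (blob Reynolds number `≤ strainConst·N₀^{β−2} = strainConst·2^{48/5}`) on the rest.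
References: T. Kato, Math. Z. 187 (1984), Thm. 2–4 [cite: Kato1984, Thm. 2–4]; H. Sohr, *The Navier–Stokes Equations* (2001),
Ch. V Thm. 1.5.1 [cite: Sohr2001, Ch. V Thm. 1.5.1]; S. Palasek, arXiv:2605.13827 §4 [cite: Palasek2026ElementaryModel, §4].
-/

noncomputable section

namespace Summit.NavierStokesRegularity.EpisodeBaseTFreeRunSmallL3

open Set MeasureTheory Metric Function
open scoped ENNReal NNReal ContDiff
open Literature.Analysis.FluidPDE
open Summit.NavierStokesRegularity.FluidComputer.PalasekTowerClayBridge
open Summit.NavierStokesRegularity.FluidComputer.PalasekTowerClayBridge.Germ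

/-- The zero force is smooth on the closed half-space. [cite: FeffermanClay2006, (5) (6)] -/
private theorem isSmoothOnHalfSpace_zero :
    IsSmoothOnHalfSpace (0 : ℝ → EuclideanSpace ℝ (Fin 3) → EuclideanSpace ℝ (Fin 3)) := by
  have h : uncurry (0 : ℝ → EuclideanSpace ℝ (Fin 3) → EuclideanSpace ℝ (Fin 3)) = fun _ => 0 := by
    funext q; rfl
  rw [IsSmoothOnHalfSpace, h]
  exact contDiffOn_const

/-- The zero force has Fefferman's space-time decay. [cite: FeffermanClay2006, (5) (6)] -/
private theorem hasRapidSpaceTimeDecay_zero :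
    HasRapidSpaceTimeDecay (0 : ℝ → EuclideanSpace ℝ (Fin 3) → EuclideanSpace ℝ (Fin 3)) := by
  intro n K
  have h : uncurry (0 : ℝ → EuclideanSpace ℝ (Fin 3) → EuclideanSpace ℝ (Fin 3)) = 0 := by
    funext q; rfl
  refine ⟨0, fun t _ x => ?_⟩
  rw [h, iteratedFDerivWithin_zero]
  simp

/-! ## §1 Every free run from an `L³`-small datum stays under `2Y₀(R)` on the first window -/

/-- **KATO'S RUN IS THE RUN.** There is `c > 0` such that, at every rates record `R`, for every smooth compactly supported
divergence-free `U` with `‖U x‖ ≤ Y₀(R)` and `‖U‖_{L³} ≤ c`, every classical finite-energy solution `(v, q)` of the free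
Navier–Stokes system (`ν = 1`) on `[1, τfirstAt R]` with `v 1 = U` satisfies `‖v t x‖ ≤ 2Y₀(R)` throughout.
[cite: Kato1984, Thm. 2–4] [cite: Sohr2001, Ch. V Thm. 1.5.1] -/
theorem freeRun_norm_le_two_mul_of_small_L3 :
    ∃ c : ℝ, 0 < c ∧ ∀ (R : TowerRates) ⦃U : EuclideanSpace ℝ (Fin 3) → EuclideanSpace ℝ (Fin 3)⦄,
      ContDiff ℝ ∞ U → HasCompactSupport U → VectorCalculus.IsDivFree U → (∀ x, ‖U x‖ ≤ R.Y 0) →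
      (eLpNorm U 3 volume).toReal ≤ c →
      ∀ ⦃v : ℝ → EuclideanSpace ℝ (Fin 3) → EuclideanSpace ℝ (Fin 3)⦄ ⦃q : ℝ → EuclideanSpace ℝ (Fin 3) → ℝ⦄,
        IsClassicalNSSolutionOn (Icc 1 (Host.τfirstAt R)) 1 0 v q → v 1 = U →
        (∃ C : ℝ≥0∞, C < ⊤ ∧ ∀ t ∈ Icc (1 : ℝ) (Host.τfirstAt R), ∫⁻ x, ‖v t x‖ₑ ^ 2 ≤ C) →
        ∀ t ∈ Icc (1 : ℝ) (Host.τfirstAt R), ∀ x, ‖v t x‖ ≤ 2 * R.Y 0 := by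
  obtain ⟨c, hc, hrun⟩ := exists_classical_run_norm_le_two_mul_Icc
  refine ⟨c, hc, fun R U hU hUc hUdiv hceil hL3 v q hv hv1 hEv t ht x => ?_⟩
  obtain ⟨u, p, hu, hu1, hEu, hbd⟩ :=
    hrun one_pos (Host.one_lt_τfirstAt R) hU hUc hUdiv (R.Y_pos 0) hceil (by rw [mul_one]; exact hL3)
  have heq := velocity_eq_of_bounded_classical_Icc one_pos zero_le_one (Host.one_lt_τfirstAt R)
    isSmoothOnHalfSpace_zero hasRapidSpaceTimeDecay_zero hu hEu hbd hv hEv (hv1.trans hu1.symm) t ht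
  rw [heq]
  exact hbd t ht x

/-! ## §2 … hence never shows the speed face of the free-run letter -/

/-- **THE SPEED FACE IS OUT OF REACH OF `L³`-SMALL FILLERS.** With `c` as in §1 and the registered band
`2Y₀(R) ≤ Y₁(R)`: for every `L³`-small admissible `U`, every classical finite-energy free run from `U` on `[1, τfirstAt R]`
and every margin `η > 0`, NO point shows `Y₁(R) + η ≤ ‖v(τfirstAt R) x‖`. [cite: Kato1984, Thm. 2–4]
[cite: Sohr2001, Ch. V Thm. 1.5.1] -/
theorem speedFace_false_of_small_L3 :
    ∃ c : ℝ, 0 < c ∧ ∀ (R : TowerRates), 2 * R.Y 0 ≤ R.Y 1 →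
      ∀ ⦃U : EuclideanSpace ℝ (Fin 3) → EuclideanSpace ℝ (Fin 3)⦄,
      ContDiff ℝ ∞ U → HasCompactSupport U → VectorCalculus.IsDivFree U → (∀ x, ‖U x‖ ≤ R.Y 0) →
      (eLpNorm U 3 volume).toReal ≤ c →
      ∀ ⦃v : ℝ → EuclideanSpace ℝ (Fin 3) → EuclideanSpace ℝ (Fin 3)⦄ ⦃q : ℝ → EuclideanSpace ℝ (Fin 3) → ℝ⦄,
        IsClassicalNSSolutionOn (Icc 1 (Host.τfirstAt R)) 1 0 v q → v 1 = U →
        (∃ C : ℝ≥0∞, C < ⊤ ∧ ∀ t ∈ Icc (1 : ℝ) (Host.τfirstAt R), ∫⁻ x, ‖v t x‖ₑ ^ 2 ≤ C) →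
        ∀ ⦃η : ℝ⦄, 0 < η → ∀ x, ¬ (R.Y 1 + η ≤ ‖v (Host.τfirstAt R) x‖) := by
  obtain ⟨c, hc, hle⟩ := freeRun_norm_le_two_mul_of_small_L3
  refine ⟨c, hc, fun R hsep U hU hUc hUdiv hceil hL3 v q hv hv1 hEv η hη x hx => ?_⟩
  have h := hle R hU hUc hUdiv hceil hL3 hv hv1 hEv (Host.τfirstAt R)
    ⟨(Host.one_lt_τfirstAt R).le, le_rfl⟩ x
  linarith

/-! ## §3 Some admissible tame carrier is that small: the free-run door's hypothesis list is empty for it -/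

/-- **FOR SOME ADMISSIBLE TAME CARRIER THE FREE-RUN LETTER IS UNSATISFIABLE.** If `2Y₀(R) ≤ Y₁(R)`, there are `a > 0`,
`λ ∈ (0, 1]` with `LevelZeroDataAt R (tameCarrierAt R a λ) 7` such that NO classical finite-energy free run on
`[1, τfirstAt R]` from the carrier shows the speed face `Y₁(R) + η` (`η > 0`) anywhere — so the hypotheses of the free-run door
(`LevelZeroDataAt.episodeBaseGAt_of_freeRun`) cannot all hold for this filler. [cite: Kato1984, Thm. 2–4]
[cite: Palasek2026ElementaryModel, §4] -/
theorem exists_levelZeroDataAt_freeRun_letter_unsatisfiable (R : TowerRates) (hsep : 2 * R.Y 0 ≤ R.Y 1) :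
    ∃ a lam : ℝ, 0 < a ∧ 0 < lam ∧ lam ≤ 1 ∧ LevelZeroDataAt R (tameCarrierAt R a lam) 7 ∧
      ∀ ⦃v : ℝ → EuclideanSpace ℝ (Fin 3) → EuclideanSpace ℝ (Fin 3)⦄ ⦃q : ℝ → EuclideanSpace ℝ (Fin 3) → ℝ⦄,
        IsClassicalNSSolutionOn (Icc 1 (Host.τfirstAt R)) 1 0 v q → v 1 = tameCarrierAt R a lam →
        (∃ C : ℝ≥0∞, C < ⊤ ∧ ∀ t ∈ Icc (1 : ℝ) (Host.τfirstAt R), ∫⁻ x, ‖v t x‖ₑ ^ 2 ≤ C) →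
        ∀ ⦃η : ℝ⦄, 0 < η → ¬ ∃ x, ‖x‖ ≤ (7 : ℝ) ∧ R.Y 1 + η ≤ ‖v (Host.τfirstAt R) x‖ := by
  obtain ⟨c, hc, hno⟩ := speedFace_false_of_small_L3
  obtain ⟨a, lam, ha, hlam, hlam1, hLZ, hL3⟩ := exists_levelZeroDataAt_eLpNorm_le R hc
  have hlt : eLpNorm (tameCarrierAt R a lam) 3 volume < ⊤ := hL3.trans_lt ENNReal.ofReal_lt_top
  have hL3' : (eLpNorm (tameCarrierAt R a lam) 3 volume).toReal ≤ c := by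
    have := (ENNReal.toReal_le_toReal hlt.ne ENNReal.ofReal_ne_top).2 hL3
    rwa [ENNReal.toReal_ofReal hc.le] at this
  refine ⟨a, lam, ha, hlam, hlam1, hLZ, fun v q hv hv1 hEv η hη hex => ?_⟩
  obtain ⟨x, -, hx⟩ := hex
  exact hno R hsep hLZ.smooth hLZ.confined.2 hLZ.divFree hLZ.ceiling hL3' hv hv1 hEv hη x hx

/-! ## §4 At the re-based register `TowerRates.tuned` -/

/-- **At `tuned`: every free run of the first tuned window from an `L³`-small admissible datum stays `≤ 2Y₀ ≤ Y₁`** — so the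
speed hypothesis `Y₁ + η ≤ ‖v(τ₁) x‖` of `Theorems.palasekTowerBreakdown_episodeBaseT_of_levelZeroDataAt_freeRun` fails at
every point for such fillers. [cite: Kato1984, Thm. 2–4] [cite: Sohr2001, Ch. V Thm. 1.5.1] -/
theorem tuned_freeRun_norm_le_Y_one_of_small_L3 :
    ∃ c : ℝ, 0 < c ∧ ∀ ⦃U : EuclideanSpace ℝ (Fin 3) → EuclideanSpace ℝ (Fin 3)⦄,
      ContDiff ℝ ∞ U → HasCompactSupport U → VectorCalculus.IsDivFree U → (∀ x, ‖U x‖ ≤ TowerRates.tuned.Y 0) →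
      (eLpNorm U 3 volume).toReal ≤ c →
      ∀ ⦃v : ℝ → EuclideanSpace ℝ (Fin 3) → EuclideanSpace ℝ (Fin 3)⦄ ⦃q : ℝ → EuclideanSpace ℝ (Fin 3) → ℝ⦄,
        IsClassicalNSSolutionOn (Icc 1 (Host.τfirstAt TowerRates.tuned)) 1 0 v q → v 1 = U →
        (∃ C : ℝ≥0∞, C < ⊤ ∧ ∀ t ∈ Icc (1 : ℝ) (Host.τfirstAt TowerRates.tuned), ∫⁻ x, ‖v t x‖ₑ ^ 2 ≤ C) →
        ∀ t ∈ Icc (1 : ℝ) (Host.τfirstAt TowerRates.tuned), ∀ x, ‖v t x‖ ≤ TowerRates.tuned.Y 1 := by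
  obtain ⟨c, hc, hle⟩ := freeRun_norm_le_two_mul_of_small_L3
  refine ⟨c, hc, fun U hU hUc hUdiv hceil hL3 v q hv hv1 hEv t ht x => ?_⟩
  have hsep := TowerRates.tuned_sep 0
  simp only [zero_add] at hsep
  exact (hle TowerRates.tuned hU hUc hUdiv hceil hL3 hv hv1 hEv t ht x).trans hsep

/-- **At `tuned`: some admissible tame carrier makes the hypothesis list of
`Theorems.palasekTowerBreakdown_episodeBaseT_of_levelZeroDataAt_freeRun` EMPTY** (no free run from it shows the speed face
`Y₁ + η`, any `η > 0`). [cite: Kato1984, Thm. 2–4] [cite: Palasek2026ElementaryModel, §4] -/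
theorem tuned_exists_tameCarrier_freeRun_letter_unsatisfiable :
    ∃ a lam : ℝ, 0 < a ∧ 0 < lam ∧ lam ≤ 1 ∧
      LevelZeroDataAt TowerRates.tuned (tameCarrierAt TowerRates.tuned a lam) 7 ∧
      ∀ ⦃v : ℝ → EuclideanSpace ℝ (Fin 3) → EuclideanSpace ℝ (Fin 3)⦄ ⦃q : ℝ → EuclideanSpace ℝ (Fin 3) → ℝ⦄,
        IsClassicalNSSolutionOn (Icc 1 (Host.τfirstAt TowerRates.tuned)) 1 0 v q →
        v 1 = tameCarrierAt TowerRates.tuned a lam →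
        (∃ C : ℝ≥0∞, C < ⊤ ∧ ∀ t ∈ Icc (1 : ℝ) (Host.τfirstAt TowerRates.tuned), ∫⁻ x, ‖v t x‖ₑ ^ 2 ≤ C) →
        ∀ ⦃η : ℝ⦄, 0 < η →
          ¬ ∃ x, ‖x‖ ≤ (7 : ℝ) ∧ TowerRates.tuned.Y 1 + η ≤ ‖v (Host.τfirstAt TowerRates.tuned) x‖ :=
  exists_levelZeroDataAt_freeRun_letter_unsatisfiable TowerRates.tuned (by simpa using TowerRates.tuned_sep 0)

end Summit.NavierStokesRegularity.EpisodeBaseTFreeRunSmallL3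

end
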